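import Literature.Computability.Complexity.IterateFP
import Literature.Computability.Complexity.TM2IterateBound
import Literature.Computability.Complexity.NondeterministicProofs
import HarnessLib

/-!
# Polynomially many iterations of an `FP` function with polynomially growing iterates

Trunk `CplxCore`, a complement to `IterateFP.lean`. There `iterate_mem_FP` packages the clocked
iteration combinator for round functions of *additive constant growth* `|F w| ≤ |w| + d`
(through `PolyTimeComputable.iterate_of_le_add`, whose size hypothesis is linear in
`|input| + rounds`). Replay machines whose state grows by an amount depending on the instance —
a round of Shor's classical driver pushes two fresh attempt budgets of length `32(|x|+1)`, a
round of an oracle-algorithm replay records a pending query of length `O(|x|)` — need the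
quadratic regime, which the loop lemma of `TM2IterateBound.lean`
(`TM2Iter.iterAux_outputsWithin_of_le`, arbitrary size bound `B`) already covers at the machine
level. This file lifts it:

* `PolyTimeComputable.iterate_of_sq`: if `|ea (F^[n] a)| ≤ d (|ea a| + n + 1)²` for all `a, n`
  then `(a, n) ↦ F^[n] a` is polynomial-time on `replicate n none ++ (ea a).map some`;
* `iterate_mem_FP_of_sq`: the `FP` string-function form, `z ↦ F^[p(|(boolUnpair z).1|)] z ∈ FP`;
* `iterate_mem_FP_of_growth`: the convenient sufficient condition — `F` keeps the first
  component `x` of its pair-coded argument and grows it by at most `c (|x| + 1)` per round.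

## References

* S. Arora, B. Barak, *Computational Complexity: A Modern Approach*, CUP 2009, §1.4.1 (clocked
  simulation with a step counter), §1.3.
-/

namespace Literature.Computability.Complexity

open _root_.Computability Polynomial

namespace TM2Iter

/-- The running-time polynomial of the loop machine in the quadratic-size regime:
`3N + 4 + N · (2B + 3 + p B)` with `B = d (N + 1)²`. [folklore] -/
noncomputable def iterPolySq (p : Polynomial ℕ) (d : ℕ) : Polynomial ℕ :=
  3 * X + 4 + X * (2 * (C d * (X + 1) ^ 2) + 3 + p.comp (C d * (X + 1) ^ 2))

/-- Evaluation of `iterPolySq`. [folklore] -/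
theorem iterPolySq_eval (p : Polynomial ℕ) (d N : ℕ) :
    (iterPolySq p d).eval N = 3 * N + 4 + N * (2 * (d * (N + 1) ^ 2) + 3 + p.eval (d * (N + 1) ^ 2)) := by
  simp [iterPolySq, Polynomial.eval_comp]

/-- **Clocked iteration, quadratic-size form**: if the encoded iterates satisfy
`|ea (F^[n] a)| ≤ d (|ea a| + n + 1)²` then `(a, n) ↦ F^[n] a` is polynomial-time computable on
`replicate n none ++ (ea a).map some` (the loop machine `TM2Iter.iterAux` with the size bound
`B = d (|ea a| + n + 1)²` in `TM2Iter.iterAux_outputsWithin_of_le`).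
[cite: AroraBarak2009, §1.4.1 (universal TM with time bound)] -/
theorem _root_.Literature.Computability.Complexity.PolyTimeComputable.iterate_of_sq {α A : Type} [Inhabited A]
    {ea : α → List A} {F : α → α} (d : ℕ)
    (hd : ∀ a n, (ea (F^[n] a)).length ≤ d * ((ea a).length + n + 1) ^ 2)
    (hF : PolyTimeComputable ea ea F) :
    PolyTimeComputable (fun q : α × ℕ => List.replicate q.2 none ++ (ea q.1).map some) ea
      (fun q => F^[q.2] q.1) := by
  obtain ⟨p, Mx, h⟩ := hF
  refine ⟨iterPolySq p d, iterAux Mx, fun q => ?_⟩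
  obtain ⟨a, n⟩ := q
  set L := (ea a).length with hL
  have hB : ∀ i ≤ n, (ea (F^[i] a)).length ≤ d * (L + n + 1) ^ 2 := fun i hi =>
    (hd a i).trans (Nat.mul_le_mul_left d (Nat.pow_le_pow_left (by omega) 2))
  have hrun := iterAux_outputsWithin_of_le Mx p h a n (d * (L + n + 1) ^ 2) hB
  refine hrun.mono ?_
  dsimp only
  rw [List.length_append, List.length_map, List.length_replicate, iterPolySq_eval, ← hL]
  set N := n + L with hN
  have h1 : d * (L + n + 1) ^ 2 = d * (N + 1) ^ 2 := by rw [hN, Nat.add_comm n L]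
  rw [h1]
  have key : n * (2 * (d * (N + 1) ^ 2) + 3 + p.eval (d * (N + 1) ^ 2)) ≤
      N * (2 * (d * (N + 1) ^ 2) + 3 + p.eval (d * (N + 1) ^ 2)) :=
    Nat.mul_le_mul_right _ (by omega)
  omega

end TM2Iter

/-- **Polynomially many rounds of an `FP` function with quadratically bounded iterates are in
`FP`.** If `F ∈ FP` and `|F^[n] z| ≤ d (|z| + n + 1)²` for all `z, n`, then for every polynomial
`p` the function `z ↦ F^[p(|(boolUnpair z).1|)] z` is in `FP` (clock layout `evalHdrFn`, recoding
`stageIt`, loop machine — as in `iterate_mem_FP`). [cite: AroraBarakCC2009, §1.4.1] -/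
theorem iterate_mem_FP_of_sq {F : List Bool → List Bool} (hF : F ∈ FP) (d : ℕ)
    (hd : ∀ z n, (F^[n] z).length ≤ d * (z.length + n + 1) ^ 2) (p : Polynomial ℕ) :
    (fun z => F^[p.eval (boolUnpair z).1.length] z) ∈ FP := by
  have h3 : PolyTimeComputable (fun q : List Bool × ℕ => List.replicate q.2 none ++ (id q.1).map some)
      (id : List Bool → List Bool) (fun q => F^[q.2] q.1) :=
    PolyTimeComputable.iterate_of_sq (ea := (id : List Bool → List Bool)) d (fun w n => by simpa using hd w n) hF
  have h := PolyTimeComputable.comp_holds h3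
    (PolyTimeComputable.comp_holds polyTimeComputable_stageIt (evalHdrFn_mem_FP p))
  have heq : ((fun q : List Bool × ℕ => F^[q.2] q.1) ∘ stageIt ∘ evalHdrFn p) =
      fun z => F^[p.eval (boolUnpair z).1.length] z := by
    funext z
    simp [Function.comp_apply, evalHdrFn, stageIt_hdr]
  rw [heq] at h
  exact h

/-- Iterates of a round function that keeps the first component `x` of its pair-coded argument
and grows the argument by at most `c (|x| + 1)` per round. [folklore] -/
theorem length_iterate_le_of_growth {F : List Bool → List Bool} (c : ℕ)
    (hfst : ∀ w, (boolUnpair (F w)).1 = (boolUnpair w).1)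
    (hd : ∀ w, (F w).length ≤ w.length + c * ((boolUnpair w).1.length + 1)) (z : List Bool) (n : ℕ) :
    (F^[n] z).length ≤ z.length + n * (c * ((boolUnpair z).1.length + 1)) := by
  have hx : ∀ n, (boolUnpair (F^[n] z)).1 = (boolUnpair z).1 := by
    intro n
    induction n with
    | zero => rfl
    | succ n ih => rw [Function.iterate_succ_apply', hfst, ih]
  induction n with
  | zero => simp
  | succ n ih =>
    rw [Function.iterate_succ_apply']
    have h1 := hd (F^[n] z)
    rw [hx n] at h1
    rw [Nat.succ_mul]
    omega

/-- **Polynomially many rounds of a first-component-preserving `FP` round function with linear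
growth are in `FP`.** If `F ∈ FP` keeps `x = (boolUnpair w).1` and `|F w| ≤ |w| + c (|x| + 1)`,
then `z ↦ F^[p(|x|)] z ∈ FP` for every polynomial `p`. [cite: AroraBarakCC2009, §1.4.1] -/
theorem iterate_mem_FP_of_growth {F : List Bool → List Bool} (hF : F ∈ FP) (c : ℕ)
    (hfst : ∀ w, (boolUnpair (F w)).1 = (boolUnpair w).1)
    (hd : ∀ w, (F w).length ≤ w.length + c * ((boolUnpair w).1.length + 1)) (p : Polynomial ℕ) :
    (fun z => F^[p.eval (boolUnpair z).1.length] z) ∈ FP := by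
  refine iterate_mem_FP_of_sq hF (c + 1) (fun z n => ?_) p
  have h := length_iterate_le_of_growth c hfst hd z n
  have hx : (boolUnpair z).1.length ≤ z.length := length_boolUnpair_fst_le z
  have h2 : n * (c * ((boolUnpair z).1.length + 1)) ≤ c * (z.length + n + 1) ^ 2 := by
    have : n * (c * ((boolUnpair z).1.length + 1)) ≤ n * (c * (z.length + 1)) :=
      Nat.mul_le_mul_left n (Nat.mul_le_mul_left c (by omega))
    refine this.trans ?_
    rw [Nat.mul_left_comm, sq]
    exact Nat.mul_le_mul_left c (Nat.mul_le_mul (by omega) (by omega))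
  have h3 : z.length ≤ (z.length + n + 1) ^ 2 := by
    rw [sq]; exact (Nat.le_add_right _ _).trans ((Nat.le_add_right _ _).trans (Nat.le_mul_of_pos_right _ (by omega)))
  calc (F^[n] z).length ≤ z.length + n * (c * ((boolUnpair z).1.length + 1)) := h
    _ ≤ (z.length + n + 1) ^ 2 + c * (z.length + n + 1) ^ 2 := Nat.add_le_add h3 h2
    _ = (c + 1) * (z.length + n + 1) ^ 2 := by ring

end Literature.Computability.Complexity
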